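import Literature.Geometry.Kaehler.ComplexTorusCyclotomicCharpolyHodgeClassesDegreeLeEight
import HarnessLib

/-!
# The SIMPLE complex torus with an endomorphism of characteristic polynomial `Φ_d`, `φ(d) = 8`, is unique; `rank MT = 5 ⟺ simple`

Layer `Literature/Geometry/Kaehler`, namespace `Literature.Geometry.Kaehler.ComplexTorus`; lane `lit-hodgefound` (Track 2
foundations library), prover seat `lit-hodgefound-p10`, generation 33, row «A2-26(hf)» (self-proposed 2026-08-28).  Theorems only;
no `def`, no instance, no named fact (net Literature debt 0).

Uniformly in `d` with `φ(d) = 8` (`d ∈ {15, 16, 20, 24, 30}`, `eq_of_totient_eq_eight`), by dispatch to this generation's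
`…OrderSixteen(Hodge)`, `…CharpolyFifteen(Hodge)`, `…CharpolyTwenty(Hodge)`, `…CharpolyTwentyFour(Hodge)`, `…CharpolyThirty`:

* **`IsSimple.isIsomorphic_of_charpoly_eq_cyclotomic_of_totient_eq_eight`**: for each `d` with `φ(d) = 8` there is only ONE
  simple complex torus (a fourfold) admitting an endomorphism with `P_u = Φ_d` — the primitive CM types of `ℚ(ζ_d)` form a
  single `Aut`-family and `h(ℚ(ζ_d)) = 1`.
* **`mtRank_hodgeStructure_eq_five_iff_isSimple_of_charpoly_eq_cyclotomic_of_totient_eq_eight`**: for a complex torus `X` with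
  `P_u = Φ_d`, `φ(d) = 8`: `rank MT(X) = 5 = dim X + 1 ⟺ X` simple (Dodson's rank for the primitive types; `≤ 3` for the
  non-simple ones).

## References

* [Shimura1998] G. Shimura, *Abelian Varieties with Complex Multiplication and Modular Functions* (1998), §7.4 Prop. 17
  p. 58, §8.2 Prop. 26, §8.4 Examples (1)–(2).
* [Dodson1984] B. Dodson, *The structure of Galois groups of CM-fields*, Trans. AMS 283 (1984), §3.3.2 Theorem p. 16.
* [BirkenhakeLange2004] Ch. Birkenhake, H. Lange, *Complex Abelian Varieties*, 2nd ed. (2004), §13.3.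
* [MoonenZarhin1999LowDim] B. Moonen, Yu. Zarhin, *Hodge classes on abelian varieties of low dimension*, Math. Ann. 315 (1999), §1 (1.2).
-/

noncomputable section

open scoped Classical nonZeroDivisors NumberField Manifold ContDiff MatrixGroups
open NumberField Module Polynomial

namespace Literature.Geometry.Kaehler

namespace ComplexTorus

open Literature.AlgebraicGeometry.Motives (HodgeTensorFacts)

variable {ι : Type} [Fintype ι] [DecidableEq ι] {E : Type} [NormedAddCommGroup E] [NormedSpace ℂ E]
  {P : (ι → ℝ) ≃L[ℝ] E} {ι' : Type} [Fintype ι'] [DecidableEq ι'] {E' : Type} [NormedAddCommGroup E']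
  [NormedSpace ℂ E'] {P' : (ι' → ℝ) ≃L[ℝ] E'} {d : ℕ}

omit [DecidableEq ι] in
/-- `P_u = Φ_d`, `φ(d) = 8 ⟹ dim X = 4`. [cite: BirkenhakeLange2004, §13.3] -/
theorem finrank_eq_four_of_charpoly_eq_cyclotomic_of_totient_eq_eight [DecidableEq ι] (P : (ι → ℝ) ≃L[ℝ] E)
    {A : Matrix ι ι ℤ} (hP : A.charpoly = cyclotomic d ℤ) (h8 : Nat.totient d = 8) : finrank ℂ E = 4 := by
  have h := two_mul_finrank_eq_totient_of_charpoly_eq_cyclotomic P hP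
  omega

/-- **FOR EACH `d` WITH `φ(d) = 8` THERE IS ONLY ONE SIMPLE COMPLEX TORUS WITH AN ENDOMORPHISM OF CHARACTERISTIC POLYNOMIAL
`Φ_d`**: any two simple ones are isomorphic. [cite: Shimura1998, §7.4 Prop. 17 p. 58, §8.2 Prop. 26, §8.4 Examples (1)–(2)]
[cite: BirkenhakeLange2004, §13.3] -/
theorem IsSimple.isIsomorphic_of_charpoly_eq_cyclotomic_of_totient_eq_eight (hX : ComplexTorus.IsSimple P)
    {A : Matrix ι ι ℤ} (hA : A ∈ endRingInt P) (hP : A.charpoly = cyclotomic d ℤ) (h8 : Nat.totient d = 8)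
    (hX' : ComplexTorus.IsSimple P') {A' : Matrix ι' ι' ℤ} (hA' : A' ∈ endRingInt P')
    (hP' : A'.charpoly = cyclotomic d ℤ) : IsIsomorphic P P' := by
  rcases eq_of_totient_eq_eight h8 with rfl | rfl | rfl | rfl | rfl
  · exact hX.isIsomorphic_of_charpoly_eq_cyclotomic_fifteen hA hP hX' hA' hP'
  · haveI : NeZero (16 : ℕ) := ⟨by norm_num⟩
    exact hX.isIsomorphic_of_orderOf_eq_sixteen hA (orderOf_eq_of_charpoly_eq_cyclotomic hA hP)
      (finrank_eq_four_of_charpoly_eq_cyclotomic_of_totient_eq_eight P hP h8) hX' hA'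
      (orderOf_eq_of_charpoly_eq_cyclotomic hA' hP') (finrank_eq_four_of_charpoly_eq_cyclotomic_of_totient_eq_eight P' hP' h8)
  · exact hX.isIsomorphic_of_charpoly_eq_cyclotomic_twenty hA hP hX' hA' hP'
  · exact hX.isIsomorphic_of_charpoly_eq_cyclotomic_twentyFour hA hP hX' hA' hP'
  · exact hX.isIsomorphic_of_charpoly_eq_cyclotomic_thirty hA hP hX' hA' hP'

/-- **`rank MT(X) = 5 ⟺ X` SIMPLE**, for a complex torus with an endomorphism of characteristic polynomial `Φ_d`, `φ(d) = 8`
(`rank MT = dim + 1` exactly for the simple ones; `3` or `2` for the others). [cite: Dodson1984, §3.3.2 Theorem (p. 16)]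
[cite: MoonenZarhin1999LowDim, §1 (1.2)] [cite: Shimura1998, §8.4 Examples (1)–(2)] -/
theorem mtRank_hodgeStructure_eq_five_iff_isSimple_of_charpoly_eq_cyclotomic_of_totient_eq_eight [HodgeTensorFacts.{0, 0}]
    {A : Matrix ι ι ℤ} (hA : A ∈ endRingInt P) (hP : A.charpoly = cyclotomic d ℤ) (h8 : Nat.totient d = 8) :
    (hodgeStructure P 1).mtRank = 5 ↔ ComplexTorus.IsSimple P := by
  rcases eq_of_totient_eq_eight h8 with rfl | rfl | rfl | rfl | rfl
  · exact mtRank_hodgeStructure_eq_five_iff_isSimple_of_charpoly_eq_cyclotomic_fifteen hA hP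
  · haveI : NeZero (16 : ℕ) := ⟨by norm_num⟩
    exact mtRank_hodgeStructure_eq_five_iff_isSimple_of_orderOf_eq_sixteen hA (orderOf_eq_of_charpoly_eq_cyclotomic hA hP)
      (finrank_eq_four_of_charpoly_eq_cyclotomic_of_totient_eq_eight P hP h8)
  · exact mtRank_hodgeStructure_eq_five_iff_isSimple_of_charpoly_eq_cyclotomic_twenty hA hP
  · exact mtRank_hodgeStructure_eq_five_iff_isSimple_of_charpoly_eq_cyclotomic_twentyFour hA hP
  · exact mtRank_hodgeStructure_eq_five_iff_isSimple_of_charpoly_eq_cyclotomic_thirty hA hP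

end ComplexTorus

end Literature.Geometry.Kaehler

end
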